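import Mathlib
import HarnessLib
import Literature.MathematicalPhysics.StatisticalMechanics.ComplexGradientStiffness
import Literature.MathematicalPhysics.StatisticalMechanics.RelevantHamiltonians

/-!
# Route `ComplexGFFStiffness` — vocabulary of the line `gnv` for the crux `HypACumulant`

Objects posited by the line `gnv` ("generalised non-vanishing") under the crux
`Summit.HubbardSuperconductivity.HubbardSuperconductivity.Theses.ComplexGFFStiffness.HypACumulant`
(item stmt-HubbardSuperconductivity-19154) and its sibling `HypALocalTwoPoint` (stmt-…-19155).
Both cruxes ask for volume-uniform statements about the complex gradient perturbation
`w_{g,0} = exp(−S_0 − i g X_0)` of the lattice free field on the tori `(ℤ/L^N)^4`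
(`Literature.MathematicalPhysics.StatisticalMechanics.ComplexGradientGFF4`); their shared first
rung is the `N`-uniform NON-VANISHING `Z_{L^N}(g,0) ≠ 0` (`ZNonvanishing`, the registered stub
`stub_zNonvanishing` of the birth skeletons).

The line `gnv` transfers `ZNonvanishing` UP to the natural general statement it is an instance of:
the representation half of Adams–Buchholz–Kotecký–Müller's Theorem 2.2 (finite-volume perturbative
partition functions of finite-range gradient perturbations of the lattice Gaussian field are
`exp(−|Λ|𝒲_N)·(1 + exponentially small)`, hence non-zero, for all perturbations `𝒦` in a ball of
the weighted `C^{r₀}` space `E_{ζ,𝒬}`, uniformly in `N`), transcribed from REAL perturbations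
`𝒦 : ℝ^d → ℝ` to COMPLEX perturbations obeying the reflection symmetry `𝒦(−z) = conj 𝒦(z)`
(`ι`-symmetry), in the instance `d = 4`, one component, nearest-neighbour forward gradients,
reference form `𝒬(z) = |z|²`, `ζ = 1/2` — `GNV` below.  The model's perturbation is
`𝒦_g(z) = exp(−i g 𝒜(z)) − 1` with the cubic vertex `𝒜(z) = z_0 (z_1² + z_2² + z_3²)`
(`berryVertex`, `pertK`), and `Z_n(g,0) = pertZ n (pertK g)` on the nose.

## Contents (definitions only; no statement is asserted)
* `ZNonvanishing`, `CumulantGivenZ`, `TwoPointGivenZ` — the stub statements of the registered birth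
  skeletons of `HypACumulant` / `HypALocalTwoPoint` (verbatim bodies, now importable from `Theorems`);
* `berryVertex`, `pertK g`, `pertZ n K` — the local cubic vertex, the complex single-site
  perturbation, and the perturbed partition function `∫ e^{−S_0(φ)} ∏_x (1 + K(∇φ(x))) dφ` for a
  general single-site gradient perturbation `K : (Fin 4 → ℝ) → ℂ`;
* `IsIotaAdmissible r₀ ρ K` — `K` is `C^{r₀}`, its derivatives of order `≤ r₀` are bounded by
  `ρ·exp(|z|²/4)` (the weight `e^{½(1−ζ)𝒬(z)}` of the reference's norm `‖·‖_{ζ,𝒬}` at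
  `ζ = 1/2`, `𝒬 = |·|²`), and `K(−z) = conj K(z)`;
* `GNV` — the generalised non-vanishing statement (a `Prop`; the line's research stub `stub_gnv`).

## References
* S. Adams, S. Buchholz, R. Kotecký, S. Müller, *Cauchy–Born rule from microscopic models with
  non-convex potentials*, arXiv:1910.13564, Sec. 2.1 (the space `E_{ζ,𝒬}`, eq. before Thm 2.2),
  Theorem 2.2, and Ch. 4 (`𝒵 = ∫ (1 + K_N) dμ` with `K_N` exponentially small)
  [AdamsBuchholzKoteckyMuller2019].

What is NOT here: no renormalisation-group object (finite-range decomposition, polymer norms, the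
maps `T_k`, fine tuning) — those belong to the proof of `GNV`, not to its statement.
-/

noncomputable section

-- `Summit.<Summit>.<Problem>`: single-conjunct summit, the duplicate component is mandated (D-0017).
set_option linter.dupNamespace false

namespace Summit.HubbardSuperconductivity.HubbardSuperconductivity.Theorems.ComplexGFF

open scoped BigOperators ComplexConjugate
open MeasureTheory
open Literature.MathematicalPhysics.StatisticalMechanics.ComplexGradientGFF4 (Z ev Y D S)

/-- **`ZNonvanishing`** — `N`-uniform non-vanishing of the untilted complex partition function
along the tower: there is `L₀` such that for every odd `L ≥ L₀` there is `g₀ = g₀(L) > 0` with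
`Z_n(g,0) ≠ 0` for all `0 ≤ g ≤ g₀`, all `N ≥ 1` and `n = L^N`.  Verbatim the statement of the
registered stub `stub_zNonvanishing` of the birth skeletons of both cruxes of the route (there a
local `def` of the crux workfile; here importable).  Not asserted. -/
def ZNonvanishing : Prop :=
  ∃ L₀ : ℕ, ∀ L : ℕ, Odd L → L₀ ≤ L → ∃ g₀ : ℝ, 0 < g₀ ∧
    ∀ g : ℝ, 0 ≤ g → g ≤ g₀ → ∀ N : ℕ, 1 ≤ N → ∀ (n : ℕ) [NeZero n], n = L ^ N → Z n g 0 ≠ 0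

/-- **`CumulantGivenZ`** — the `N`-uniform second-cumulant bound for the tilt response `Y_u`
GIVEN non-vanishing (`[ABKM19]` Thm 2.2, `ℓ = 2`, along the real tilt, transcribed to the
`ι`-symmetric complex class, with `Z ≠ 0` among the hypotheses).  Verbatim the statement of the
registered stub `stub_cumulantGivenZ` of the birth skeleton of `HypACumulant`.  Not asserted. -/
def CumulantGivenZ : Prop :=
  ∃ L₀ : ℕ, ∀ L : ℕ, Odd L → L₀ ≤ L → ∃ g₀ C : ℝ, 0 < g₀ ∧
    ∀ g : ℝ, 0 ≤ g → g ≤ g₀ → ∀ N : ℕ, 1 ≤ N → ∀ (n : ℕ) [NeZero n], n = L ^ N → Z n g 0 ≠ 0 →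
      ∀ u : Fin 4 → ℝ,
        ‖ev n g (fun φ => ((Y u φ ^ 2 : ℝ) : ℂ)) - (ev n g (fun φ => ((Y u φ : ℝ) : ℂ))) ^ 2‖
          ≤ C * (Fintype.card (Fin 4 → ZMod n) : ℝ) * ∑ i : Fin 4, (u i) ^ 2

/-- **`TwoPointGivenZ`** — the `N`-uniform, `K`-uniform `O(g)` bound on the nearest-neighbour
cosine two-point function GIVEN non-vanishing (`[ABKM19]` Thm 2.2, `ℓ = 1`, with the bounded-range
observable `cos(z_i/√K)`, transcribed to the `ι`-symmetric complex class).  Verbatim the statement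
of the registered stub `stub_twoPointGivenZ` of the birth skeleton of the sibling crux
`HypALocalTwoPoint` (stmt-HubbardSuperconductivity-19155), which shares the first rung
`ZNonvanishing`.  Not asserted. -/
def TwoPointGivenZ : Prop :=
  ∃ L₀ : ℕ, ∀ L : ℕ, Odd L → L₀ ≤ L → ∃ g₀ C : ℝ, 0 < g₀ ∧
    ∀ g : ℝ, 0 ≤ g → g ≤ g₀ → ∀ N : ℕ, 1 ≤ N → ∀ (n : ℕ) [NeZero n], n = L ^ N → Z n g 0 ≠ 0 →
      ∀ K : ℝ, 1 ≤ K → ∀ (x : Fin 4 → ZMod n) (i : Fin 4),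
        ‖ev n g (fun φ => ((Real.cos (D φ i x / Real.sqrt K) : ℝ) : ℂ))
            - ev n 0 (fun φ => ((Real.cos (D φ i x / Real.sqrt K) : ℝ) : ℂ))‖ ≤ C * g

/-- The local cubic ("Berry") vertex as a function of the gradient vector `z = ∇φ(x) ∈ ℝ⁴`:
`𝒜(z) = z_0 · (z_1² + z_2² + z_3²)`, so that `X_0(φ) = Σ_x 𝒜(∇φ(x))`
(`ComplexGradientGFF4.X` at zero tilt).  Homogeneous of degree `3`, odd. -/
def berryVertex (z : Fin 4 → ℝ) : ℝ :=
  z 0 * ∑ j : Fin 3, (z j.succ) ^ 2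

/-- The model's single-site complex gradient perturbation `𝒦_g(z) = exp(−i·g·𝒜(z)) − 1`
(`ComplexGradientGFF4.w` at zero tilt is `e^{−S_0(φ)} ∏_x (1 + 𝒦_g(∇φ(x)))`).  It satisfies the
reflection symmetry `𝒦_g(−z) = conj 𝒦_g(z)` and `|1 + 𝒦_g| = 1` (the perturbation `𝒦` of
ABKM19 = arXiv:1910.13564, Sec. 2.1, here complex). -/
def pertK (g : ℝ) (z : Fin 4 → ℝ) : ℂ :=
  Complex.exp (-(Complex.I * ((g * berryVertex z : ℝ) : ℂ))) - 1

/-- The perturbed partition function of a general single-site gradient perturbation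
`K : ℝ⁴ → ℂ` of the lattice free field on the torus `(ℤ/n)^4` (with the rank-one zero-mode mass of
`ComplexGradientGFF4.S`): `pertZ n K = ∫_{ℝ^Λ} e^{−S_0(φ)} ∏_{x ∈ Λ} (1 + K(∇φ(x))) dφ`, where
`∇φ(x) = (∂_0φ(x), …, ∂_3φ(x))` are the forward lattice gradients.  This is the reference's
`𝒵_N(𝒦, 𝒬)` for `𝒬 = |·|²`, up to the positive Gaussian factor of the zero mode (Lebesgue
integral over all fields instead of zero-average fields; a junk value `0` if the integrand is not
integrable, which does not happen for admissible `K`).  (ABKM19, Sec. 2.1.) -/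
def pertZ (n : ℕ) [NeZero n] (K : (Fin 4 → ℝ) → ℂ) : ℂ :=
  ∫ φ : (Fin 4 → ZMod n) → ℝ,
    Complex.exp (-((S 0 φ : ℝ) : ℂ)) * ∏ x : Fin 4 → ZMod n, (1 + K (fun i => D φ i x))

/-- **`ι`-admissible perturbations** (the ball of radius `ρ` of the reference's Banach space
`E_{ζ,𝒬}` at `ζ = 1/2`, `𝒬(z) = |z|² = Σ_i z_i²`, intersected with the `ι`-symmetric class, for
complex-valued `K`): `K : ℝ⁴ → ℂ` is `C^{r₀}` (as a map of real normed spaces), every derivative of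
order `k ≤ r₀` is bounded in operator norm by `ρ · exp(Σ_i z_i² / 4)` — i.e. by `ρ` times the
weight `e^{½(1−ζ)𝒬(z)}` — and `K(−z) = conj K(z)` for all `z`.  (Multilinear operator norms on
`Fin 4 → ℝ` with its sup norm replace the reference's `Σ_{|α| ≤ r₀} |∂^α K(z)|/α!`; the two are
equivalent up to constants depending only on `r₀`, immaterial since `ρ` is existential in `GNV`.)
(ABKM19, Sec. 2.1, the norm `‖·‖_{ζ,𝒬}` displayed before Theorem 2.2.) -/
def IsIotaAdmissible (r₀ : ℕ) (ρ : ℝ) (K : (Fin 4 → ℝ) → ℂ) : Prop :=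
  ContDiff ℝ r₀ K ∧
    (∀ k : ℕ, k ≤ r₀ → ∀ z : Fin 4 → ℝ,
      ‖iteratedFDeriv ℝ k K z‖ ≤ ρ * Real.exp ((∑ i : Fin 4, (z i) ^ 2) / 4)) ∧
    (∀ z : Fin 4 → ℝ, K (-z) = conj (K z))

/-- **`GNV` — generalised non-vanishing** (the research stub of the line `gnv`; a `Prop`, NOT
asserted and NOT in print): for some order `r₀`, there is `L₀` such that for every odd `L ≥ L₀`
there is `ρ = ρ(L) > 0` with `pertZ n K ≠ 0` for every `N ≥ 1`, `n = L^N`, and every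
`ι`-admissible perturbation `K` with `IsIotaAdmissible r₀ ρ K`.  For REAL `K` (and general `d`,
`m`, range, `ζ`, `𝒬`) this is contained in the reference's Theorem 2.2 via its Ch. 4
(`𝒵_N = e^{−L^{dN}𝒲_N}`-type representation `∫(1 + K_N)dμ` with `‖K_N‖ ≤ Cη^N`); the line's bet is
that the proof runs verbatim on the `ι`-symmetric complex class (every renormalisation-group map is
`ι`-equivariant, so the fine-tuned quadratic form stays real).  `GNV → ZNonvanishing` is the landed
reduction `zNonvanishing_of_gnv`.  (Source of the real case: ABKM19, Theorem 2.2 and Ch. 4.) -/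
def GNV : Prop :=
  ∃ r₀ : ℕ, ∃ L₀ : ℕ, ∀ L : ℕ, Odd L → L₀ ≤ L → ∃ ρ : ℝ, 0 < ρ ∧
    ∀ N : ℕ, 1 ≤ N → ∀ (n : ℕ) [NeZero n], n = L ^ N →
      ∀ K : (Fin 4 → ℝ) → ℂ, IsIotaAdmissible r₀ ρ K → pertZ n K ≠ 0

/-! ## Gaussian data of the line `gnv` (appended 2026-08-27, lead prover g2)

The matrices of the free action `S_0(φ) = ½ (φ, A φ)`, `A = −Δ_Λ + P_0` on `Λ = (ℤ/n)^4`
(`Theorems/ComplexGFFStiffnessHypACumulantGaussRep.lean` proves `(φ, Aφ) = 2 S_0(φ)`, `A ≻ 0`), the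
normalised free measure `μ^{(0)} = e^{−S_0} dφ / Z_0` of the reference (ABKM19, arXiv:1910.13564,
(4.1)/(4.4): `𝒵_N(𝒦) = ∫ Σ_X ∏_{x∈X} 𝒦(∇φ(x)) μ^{(0)}(dφ)`), and the passage `squeeze` from the
one-component fields `Λ → Fin 1 → ℝ` of the tree's Gaussian library
(`Literature.Barriers.CriticalPhenomena.LongRangePhi4.fieldGaussian`) to scalar fields `Λ → ℝ`.
Definitions only; every statement about them is in the GaussRep file. -/

section GaussianData

variable {n : ℕ}

variable (n) in
/-- The forward-gradient matrix `∇_i` on `Λ = (ℤ/n)^4`: `(∇_i φ)(s) = φ(s + e_i) − φ(s)`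
(`gradMat_mulVec`: `∇_i φ = ∂_iφ = ComplexGradientGFF4.D φ i`). (ABKM19, Sec. 2.1 / Ch. 6.1:
forward lattice derivatives.) -/
def gradMat (i : Fin 4) : Matrix (Fin 4 → ZMod n) (Fin 4 → ZMod n) ℝ :=
  fun s t => (if t = s + Pi.single i 1 then (1 : ℝ) else 0) - (if t = s then (1 : ℝ) else 0)

variable (n) in
/-- The lattice Laplacian of forward gradients on `Λ = (ℤ/n)^4`, `−Δ_Λ = Σ_i ∇_iᵀ ∇_i`
(`dotProduct_lapMat_mulVec`: `(φ, −Δ_Λφ) = Σ_{x,i} (∂_iφ(x))²`). (ABKM19, Ch. 6.1, the operator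
`𝒜 = ∇*∇` of the Gaussian measure `μ^{(0)}`.) -/
def lapMat [NeZero n] : Matrix (Fin 4 → ZMod n) (Fin 4 → ZMod n) ℝ :=
  ∑ i : Fin 4, (gradMat n i).transpose * gradMat n i

variable (n) in
/-- The zero-mode projection `P_0 = |Λ|⁻¹ 𝟙𝟙ᵀ` on `Λ = (ℤ/n)^4` (the rank-one zero-mode mass of
`ComplexGradientGFF4.S`: `(φ, P_0 φ) = (Σ_x φ(x))²/|Λ|`). -/
def zeroModeMat [NeZero n] : Matrix (Fin 4 → ZMod n) (Fin 4 → ZMod n) ℝ :=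
  Matrix.of fun _ _ => ((Fintype.card (Fin 4 → ZMod n) : ℝ))⁻¹

variable (n) in
/-- The matrix `A = −Δ_Λ + P_0` of the free action: `S_0(φ) = ½ (φ, A φ)`
(`dotProduct_massMat_mulVec`), positive definite (`posDef_massMat`); its inverse `A⁻¹` is the
covariance of the normalised free measure `μ^{(0)}`. -/
def massMat [NeZero n] : Matrix (Fin 4 → ZMod n) (Fin 4 → ZMod n) ℝ :=
  lapMat n + zeroModeMat n

variable (n) in
/-- The normalised free lattice Gaussian measure `μ^{(0)} = e^{−S_0(φ)} dφ / ∫ e^{−S_0}` on field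
space `ℝ^Λ`, `Λ = (ℤ/n)^4` (Lebesgue measure tilted by `−S_0`; a probability measure,
`isProbabilityMeasure_gffMeasure`).  The reference's `μ^{(0)}` lives on zero-average fields; here
the rank-one zero-mode mass of `ComplexGradientGFF4.S` replaces that constraint, and
`pertZ n K = Z_0 · ∫ ∏_x (1 + K(∇φ(x))) dμ^{(0)}` (`pertZ_eq_mul_integral_gffMeasure`).
(ABKM19, (4.1)/(4.4).) -/
def gffMeasure [NeZero n] : MeasureTheory.Measure ((Fin 4 → ZMod n) → ℝ) :=
  (MeasureTheory.volume : MeasureTheory.Measure ((Fin 4 → ZMod n) → ℝ)).tilted fun φ => -(S 0 φ)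

/-- One-component fields `Λ → Fin 1 → ℝ` of the tree's Gaussian library
(`LongRangePhi4.fieldGaussian Λ C 1`) squeezed to scalar fields `Λ → ℝ`. -/
def squeeze (φ : (Fin 4 → ZMod n) → Fin 1 → ℝ) : (Fin 4 → ZMod n) → ℝ := fun x => φ x 0

variable (n) in
/-- `squeeze` as a measurable equivalence: the product over `Λ` of `ℝ^{Fin 1} ≃ᵐ ℝ`
(Lebesgue-measure preserving, `measurePreserving_squeezeEquiv`). -/
def squeezeEquiv : ((Fin 4 → ZMod n) → Fin 1 → ℝ) ≃ᵐ ((Fin 4 → ZMod n) → ℝ) :=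
  MeasurableEquiv.piCongrRight fun _ => MeasurableEquiv.funUnique (Fin 1) ℝ

variable (n) in
/-- The MEAN-ZERO GREEN'S FUNCTION of the forward-gradient Laplacian on `Λ = (ℤ/n)^4`:
`G = A⁻¹ − P_0` (`A = −Δ_Λ + P_0`), i.e. `G = A⁻¹ (−Δ_Λ) A⁻¹` — the pseudo-inverse of `−Δ_Λ`
(`(−Δ_Λ) G = 1 − P_0`, `G 𝟙 = 0`, `G ⪰ 0`; Theorems/…GreenSplit).  This is the operator
`𝒞^{(0)} = 𝒜⁻¹` of the reference on zero-average fields, the object the finite-range decomposition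
`G = Σ_k 𝒞_k` (`GradientFRD.TorusFRD`, `stub_frd`) decomposes; the free measure factorises as
`P_{A⁻¹} = P_G ∗ P_{P_0}` and gradient functionals see only `P_G`. (ABKM19, Ch. 6.1.) -/
def greenMat [NeZero n] : Matrix (Fin 4 → ZMod n) (Fin 4 → ZMod n) ℝ :=
  (massMat n)⁻¹ - zeroModeMat n

end GaussianData

/-! ## Weight data of the line `gnv` (appended 2026-08-27, lead prover g4)

The scale-`0` large-field weight of the line is `w_X(φ) = exp(¼ Σ_{x∈X} |∇φ(x)|²)` (the weight of
`IsIotaAdmissible`, [ABKM19] (12.13) with `1 − 4θ̄ = ½`), i.e. `exp(½ (φ, A_X φ))` for the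
DIRICHLET FORM ON `X`, `A_X = ½ Σ_i ∇_iᵀ 1_X ∇_i` — the gradient part of the seed `A_0^X` of the
weight tower (`Literature.….GradientRG.WeightData`, ABKM19 (7.5) first line).  Definition only;
its properties (symmetric, `⪰ 0`, monotone and additive in `X`, local on `X ∪ (X + e_i)`) are in
`Theorems/ComplexGFFStiffnessHypACumulantWeightSeed.lean`. -/

section WeightSeed

variable {n : ℕ}

variable (n) in
/-- **The Dirichlet form on `X`**: `dirichletForm n X = ½ Σ_i ∇_iᵀ · diag(1_X) · ∇_i` on
`Λ = (ℤ/n)^4`, so that `(φ, dirichletForm n X φ) = ½ Σ_{x∈X} Σ_i (∂_iφ(x))²` and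
`exp(½(φ, dirichletForm n X φ)) = exp(¼ Q_X(φ))` is the scale-`0` weight of the line
(ABKM19, (7.5) first line with `Ω(z) = ½|z|²`, `1 − 4θ̄ = ½`; (12.13)). -/
def dirichletForm [NeZero n] (X : Finset (Fin 4 → ZMod n)) : Matrix (Fin 4 → ZMod n) (Fin 4 → ZMod n) ℝ :=
  (1/2 : ℝ) • ∑ i : Fin 4, (gradMat n i).transpose *
    Matrix.diagonal (fun x => if x ∈ X then (1 : ℝ) else 0) * gradMat n i

end WeightSeed

/-! ## The `ι`-symmetric class (appended 2026-08-27, lead prover g6)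

The reflection `ι : F ↦ (φ ↦ conj F(−φ))` of complex field functionals.  The line `gnv` runs the
renormalisation group of [ABKM19] on the `ι`-SYMMETRIC class: polymer functionals with
`K(X, −φ) = conj K(X, φ)` and relevant Hamiltonians with real constant and quadratic and imaginary
linear coefficients (`H(B, −φ) = conj H(B, φ)`, `Theorems/…IotaHamiltonian`).  The model's activity
`𝒦_g` is `ι`-symmetric (`pertK_neg`), and `Theorems/…IotaStep` proves that the renormalisation
transformation `T_k` preserves the class — so the fine-tuned quadratic form stays real.
Definitions only. -/

section Iota

variable {d M : ℕ}

/-- **`ι`-Hamiltonian**: a complex relevant Hamiltonian with real constant and quadratic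
coefficients and imaginary linear coefficients — equivalently `H(B, −φ) = conj H(B, φ)` for all
blocks (ABKM19's `M_0 ⊗ ℂ` intersected with the `ι`-symmetric class). -/
def IsIotaHam (H : Literature.MathematicalPhysics.StatisticalMechanics.GradientRG.RelevantHamiltonian ℂ d) :
    Prop :=
  (∀ u : Unit, conj (H (Sum.inl u)) = H (Sum.inl u)) ∧
    (∀ α : Literature.MathematicalPhysics.StatisticalMechanics.GradientRG.linIndex d,
      conj (H (Sum.inr (Sum.inl α))) = -H (Sum.inr (Sum.inl α))) ∧
    (∀ q : Literature.MathematicalPhysics.StatisticalMechanics.GradientRG.quadIndex d,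
      conj (H (Sum.inr (Sum.inr q))) = H (Sum.inr (Sum.inr q)))

/-- **`ι`-symmetric polymer functional** on the torus `(ℤ/M)^d`: `K(X, −φ) = conj K(X, φ)` for every
polymer `X` and field `φ` (the complexification of ABKM19's real class `M(𝓟_k)` on which the
reflection acts trivially). -/
def IsIotaFun (K : Finset (Fin d → ZMod M) → ((Fin d → ZMod M) → ℝ) → ℂ) : Prop :=
  ∀ X φ, K X (-φ) = conj (K X φ)

end Iota

/-! ## One-point functions of the line `gnv` for the sibling crux `HypALocalTwoPoint`
(appended 2026-08-31, prover `leafhand-hubbard-cgffstiff-2`)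

The registered stub `stub_twoPointGivenZ : TwoPointGivenZ` of stmt-HubbardSuperconductivity-19155 asks
for `|⟨cos(∂_iφ(x)/√K)⟩_g − ⟨cos(∂_iφ(x)/√K)⟩_0| ≤ C·g` uniformly in the volume.  By translation
invariance of the torus `⟨F(∇φ(x))⟩_g = |Λ|⁻¹ Σ_y ⟨F(∇φ(y))⟩_g` is the TRANSLATION-AVERAGED one-point
function of the single-site perturbation `𝒦_g = pertK g` paired with the local gradient observable
`G = cos(z_i/√K)` — the first derivative at `s = 0` of `|Λ|⁻¹ log pertZ n (𝒦_g + s·G·(1+𝒦_g))`,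
i.e. [ABKM19] Theorem 2.2 with `ℓ = 1` (no source field / observable insertion is needed).  The stub is
thus an instance of the LIPSCHITZ CONTINUITY IN THE PERTURBATION of such one-point functions
(`W_N ∈ C^{1,1}` uniformly in `N`), stated below as `OnePointLipschitz` in the vocabulary of `GNV`;
`Theorems/ComplexGFFStiffnessHypALocalTwoPointReduction.lean` proves `OnePointLipschitz → TwoPointGivenZ`.
The Gaussian weight of the perturbations and of the observable is `exp(|z|²/8)` each, so that the
perturbation direction `G·(1+𝒦)` lies in the reference's ball of `E_{1/2,|·|²}` (weight `exp(|z|²/4)`,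
`IsIotaAdmissible`).  Definitions only; nothing is asserted. -/

section OnePoint

/-- **Weighted `ι`-admissibility with Gaussian weight `exp(a·|z|²)`**: `K : ℝ⁴ → ℂ` is `C^{r₀}`, every
derivative of order `k ≤ r₀` is bounded in operator norm by `ρ · exp(a · Σ_i z_i²)`, and
`K(−z) = conj K(z)`.  `IsIotaAdmissible r₀ ρ` is the case `a = 1/4` (the reference's `‖·‖_{ζ,𝒬}`-ball at
`ζ = 1/2`, `𝒬 = |·|²`); `a = 1/8` (`ζ = 3/4`) is the class of `OnePointLipschitz`, and `a = 0` contains the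
bounded observables `cos(z_i/√K)`.  (ABKM19, Sec. 2.1, the norm `‖𝒦‖_{ζ,𝒬} = sup_z Σ_{|α|≤r₀} |∂^α𝒦(z)|
e^{−½(1−ζ)𝒬(z)}`.) -/
def IsIotaAdmissibleWt (r₀ : ℕ) (a ρ : ℝ) (K : (Fin 4 → ℝ) → ℂ) : Prop :=
  ContDiff ℝ r₀ K ∧
    (∀ k : ℕ, k ≤ r₀ → ∀ z : Fin 4 → ℝ,
      ‖iteratedFDeriv ℝ k K z‖ ≤ ρ * Real.exp (a * ∑ i : Fin 4, (z i) ^ 2)) ∧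
    (∀ z : Fin 4 → ℝ, K (-z) = conj (K z))

/-- **The translation-averaged one-point function** of a local gradient observable `G : ℝ⁴ → ℂ` in the
perturbed state of a single-site gradient perturbation `K` on the torus `Λ = (ℤ/n)^4`:
`onePoint n K G = (∫ (Σ_{x∈Λ} G(∇φ(x))) · e^{−S_0(φ)} ∏_{y∈Λ} (1 + K(∇φ(y))) dφ) / (|Λ| · pertZ n K)`
— i.e. `|Λ|⁻¹ Σ_x ⟨G(∇φ(x))⟩_K`, which for a translation-invariant state is `⟨G(∇φ(x))⟩_K` at any site
(`Theorems/…HypALocalTwoPointTranslation`); for `K = pertK g` and `G = cos(z_i/√K)` it is the cosine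
two-point function `ev n g (cos(∂_iφ(x)/√K))` of `TwoPointGivenZ`.  Equivalently the derivative at
`s = 0` of `|Λ|⁻¹ log pertZ n (K + s·G·(1+K))` ([ABKM19] (2.9)/(4.4), `ℓ = 1`).  A junk value when
`pertZ n K = 0` (every use carries `pertZ n K ≠ 0`). (ABKM19, Sec. 2.1, Theorem 2.2 with `ℓ = 1`.) -/
def onePoint (n : ℕ) [NeZero n] (K G : (Fin 4 → ℝ) → ℂ) : ℂ :=
  (∫ φ : (Fin 4 → ZMod n) → ℝ,
      (∑ x : Fin 4 → ZMod n, G (fun i => D φ i x)) *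
        (Complex.exp (-((S 0 φ : ℝ) : ℂ)) * ∏ x : Fin 4 → ZMod n, (1 + K (fun i => D φ i x)))) /
    ((Fintype.card (Fin 4 → ZMod n) : ℂ) * pertZ n K)

/-- **`OnePointLipschitz` — `N`-uniform Lipschitz continuity of the one-point functions in the
perturbation** (a `Prop`, NOT asserted; the research statement the stub `stub_twoPointGivenZ` reduces
to, and the `ℓ ≤ 2` content of [ABKM19] Theorem 2.2 on the `ι`-symmetric complex class): for some order
`r₀` there is `L₀` such that for every odd `L ≥ L₀` there are `ρ = ρ(L) > 0` and `C = C(L)` with, for all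
`N ≥ 1`, `n = L^N`, all perturbations `K, K'` and observables `G` that are `ι`-admissible with Gaussian
weight `exp(|z|²/8)` and sizes `ρ, ρ, 1`, with `‖K − K'‖ ≤ δ` in the same weighted `C^{r₀}` sense, and
with `pertZ n K ≠ 0 ≠ pertZ n K'`:  `‖onePoint n K G − onePoint n K' G‖ ≤ C · δ`.
For REAL perturbations this is contained in the smoothness half of the reference's Theorem 2.2
(`𝒲_N ∈ C²` on a ball of `E_{ζ,𝒬}` with `N`-uniform bounds, `ζ = 1/2`: the direction `G·(1+K)` has
weight `exp(|z|²/4)`); the route's bet, as for `GNV`, is that the proof runs verbatim on the `ι`-symmetric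
class.  The same statement with `G = Q_u` quadratic yields the second-cumulant stub `CumulantGivenZ` of
the sibling crux (`⟨Y_u²⟩ − ⟨Y_u⟩² = ∂_t|₀ |Λ|·onePoint n ((1+𝒦_g)e^{tQ_u} − 1) Q_u`).
(Source of the real case: ABKM19, Theorem 2.2 (`ℓ = 1, 2`) and Ch. 4, eqs. (4.4)–(4.12).) -/
def OnePointLipschitz : Prop :=
  ∃ r₀ : ℕ, ∃ L₀ : ℕ, ∀ L : ℕ, Odd L → L₀ ≤ L → ∃ ρ C : ℝ, 0 < ρ ∧
    ∀ N : ℕ, 1 ≤ N → ∀ (n : ℕ) [NeZero n], n = L ^ N →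
      ∀ (K K' G : (Fin 4 → ℝ) → ℂ) (δ : ℝ),
        IsIotaAdmissibleWt r₀ (1 / 8) ρ K → IsIotaAdmissibleWt r₀ (1 / 8) ρ K' →
        IsIotaAdmissibleWt r₀ (1 / 8) 1 G → 0 ≤ δ →
        IsIotaAdmissibleWt r₀ (1 / 8) δ (fun z => K z - K' z) →
        pertZ n K ≠ 0 → pertZ n K' ≠ 0 →
          ‖onePoint n K G - onePoint n K' G‖ ≤ C * δ

end OnePoint

/-! ## The free-energy difference bounds (appended 2026-08-31, prover `leafhand-hubbard-cgffstiff-2`)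

The research statement BOTH open stubs of the route reduce to: an `N`-uniform `C^{1,1}`-regularity of the
finite-volume free energy in the perturbation, in DIFFERENCE form (no derivative of any
renormalisation-group map is needed).  `Theorems/ComplexGFFStiffnessHypALocalTwoPointFreeEnergyReduction`
proves `FreeEnergyBounds → OnePointLipschitz` (hence `→ TwoPointGivenZ`); for REAL perturbations it is
the `ℓ ≤ 2` content of [ABKM19] Theorem 2.2 with Ch. 4 (`𝒵_N(𝒦) = e^{−L^{dN}𝒲_N(𝒦)}(1 + o(1))`,
`𝒲_N ∈ C²` with `N`-uniform bounds); the route's bet is the `ι`-symmetric complex class.  Definition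
only; nothing is asserted. -/

section FreeEnergy

/-- **`FreeEnergyBounds`** (a `Prop`, NOT asserted): for some order `r₀` there is `L₀` such that for
every odd `L ≥ L₀` there are `ρ = ρ(L) > 0`, `C = C(L) ≥ 0` with, on every torus `(ℤ/L^N)^4`, `N ≥ 1`,
a "free energy" `f : (ℝ⁴ → ℂ) → ℂ` and a constant `c` such that `pertZ n K = c · exp(f K)` for every
`ι`-admissible `K` in the ball of radius `ρ` (`IsIotaAdmissible r₀ ρ`, the reference's `E_{1/2}`-ball),
with FIRST DIFFERENCES `‖f(K+U) − f(K)‖ ≤ C·|Λ|·δ` (`‖U‖ ≤ δ` in the sense `IsIotaAdmissible r₀ δ U`,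
both ends in the ball) and MIXED SECOND DIFFERENCES
`‖f(K+U+V) − f(K+U) − f(K+V) + f(K)‖ ≤ C·|Λ|·δ₁·δ₂` (four corners in the ball, `‖U‖ ≤ δ₁`, `‖V‖ ≤ δ₂`)
— i.e. `|Λ|⁻¹ f` is Lipschitz with Lipschitz first differences, uniformly in `N`.
(Source of the real case: ABKM19, Theorem 2.2 and Ch. 4, eqs. (4.4)–(4.12), Ch. 12.) -/
def FreeEnergyBounds : Prop :=
  ∃ r₀ : ℕ, ∃ L₀ : ℕ, ∀ L : ℕ, Odd L → L₀ ≤ L → ∃ ρ C : ℝ, 0 < ρ ∧ 0 ≤ C ∧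
    ∀ N : ℕ, 1 ≤ N → ∀ (n : ℕ) [NeZero n], n = L ^ N →
      ∃ f : ((Fin 4 → ℝ) → ℂ) → ℂ, ∃ c : ℂ,
        (∀ K, IsIotaAdmissible r₀ ρ K → pertZ n K = c * Complex.exp (f K)) ∧
        (∀ (K U : (Fin 4 → ℝ) → ℂ) (δ : ℝ), IsIotaAdmissible r₀ ρ K →
            IsIotaAdmissible r₀ ρ (fun z => K z + U z) → 0 ≤ δ → IsIotaAdmissible r₀ δ U →
            ‖f (fun z => K z + U z) - f K‖ ≤ C * (Fintype.card (Fin 4 → ZMod n) : ℝ) * δ) ∧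
        (∀ (K U V : (Fin 4 → ℝ) → ℂ) (δ₁ δ₂ : ℝ), IsIotaAdmissible r₀ ρ K →
            IsIotaAdmissible r₀ ρ (fun z => K z + U z) → IsIotaAdmissible r₀ ρ (fun z => K z + V z) →
            IsIotaAdmissible r₀ ρ (fun z => K z + U z + V z) → 0 ≤ δ₁ → 0 ≤ δ₂ →
            IsIotaAdmissible r₀ δ₁ U → IsIotaAdmissible r₀ δ₂ V →
            ‖f (fun z => K z + U z + V z) - f (fun z => K z + U z) - f (fun z => K z + V z) + f K‖
              ≤ C * (Fintype.card (Fin 4 → ZMod n) : ℝ) * δ₁ * δ₂)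

end FreeEnergy

end Summit.HubbardSuperconductivity.HubbardSuperconductivity.Theorems.ComplexGFF

end
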